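/-
Copyright (c) 2026 the pub-hodgecm-mathlib formalisation cell (harness21).  Prover seat hodgecm-mathlib-R90-C131-p05 (g3) on the S4 valve (dealer K2E2-plan (g8), S4-R84;
second reader K2E4-p11 (g10)), road (J̃♭) FILE (TJ6) «HERBRAND WINDOW», LETTERS: the datum-level dischargers of ★ FILE 3a `R90S4TwistedHerbrandWindow`'s algebraic
letters (`𝔞`, `θ`, `ε ∘ ε`, `T′ = T̃^ε`) in the one-place MODEL frame of ★ p865006 ∕ p865097.
Crux H413 `stmt-HodgeConjecture-24833`, lane `--supports … --as helper` (count-neutral).  THEOREMS ONLY (no `def`, no `instance`, no notation, no named-fact hypothesis, no `sorry`).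
-/
import Summits.HodgeConjecture.HodgeConjecture.Theorems.R90S4TwistedTubeModelChart   -- ★ p864971 (M-2): brings ★ C4u∕C2 (`cayley`, `isUnit_det_one_sub_of_valBound`, `cayley_comm_of_comm`), ★ C8b-frame `comm_of_cayley_comm`, ★ (TJ1) `tau_inv`∕`tau_tau`∕`tau_smul`, ★ `CentraliserOfSeparableCharpoly`, ★ `exists_natCast_valuation_lt_one`
import Summits.HodgeConjecture.HodgeConjecture.Theorems.R90S4TwistedTubeDatum        -- ★ p864838 DATUM: `exists_mul_pow_le_one_of_lt_one` (absorb a bound into a power of `α`)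
import Summits.HodgeConjecture.HodgeConjecture.Theorems.R90S4TwistedTubeSweep        -- ★ p864668 (TJ5) [C] part 1: `mem_epsCentralizer_iff_map_eq_of_commute` (`G̃_{δε} ∩ Cent(δ) = ε`-fixed points)
import HarnessLib

/-!
# R90-TF · S4 (Ch. 13.1–2) · road (J̃♭) FILE (TJ6) «HERBRAND WINDOW», LETTERS: the commutant algebra `𝔞 = Z(γ)`, an anti-fixed scalar `θ`, `ε ∘ ε = id`, and `T′ = T̃^ε`

Cell `hodgecm-mathlib`, crux H413 (`stmt-HodgeConjecture-24833`, lane `--supports … --as helper`), route of record `HCCMUnconditional` (no route verbs; count-neutral).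
Programme R90-TF, section S4 = [Rogawski1990] Ch. 13.1–13.2; seat R90-C131-p05 (g3); ORDER = S4 dealer K2E2-plan (g8) S4-R84 («LETTERS FILE → C131-p05»).
★ FILE 3a `R90S4TwistedHerbrandWindow.herbrandWindow_index` (R90-C131-p02 (g2)) proves the Herbrand index identity of the Cayley window HYPOTHESIS-FIRST on algebraic
letters that the (J̃♭-Σ) datum (K2E3-p31 (g3)) does not carry as such: a commutative, inversion-closed, closed SUBALGEBRA `𝔞 ⊆ M_m(K)` linked to the torus through the
chart (`h𝔞 h𝔞c h𝔞i h𝔞cl`), an ANTI-FIXED scalar `θ` (`hθ0 hθ1 hEθ`), the involutivity of `ε` on `A` (`hεε`) and the description `T′ = A^ε` (`hP'ε`).  THIS FILE discharges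
them in the one-place MODEL frame of ★ (M-3a) p865006 ∕ (M-3b) p865097 (`ρ : G →* GL_m(K)` injective, `σ` an involution of `K`, `J` hermitian invertible, `ε` read by
`ρ(ε g) = J⁻¹ ((ρ g)⁻¹.map σ)ᵀ J`, `T = ρ⁻¹ Cent(γ)` for a regular `γ`, chart `c` with `ρ(c X) = cayley X` on the ball `X ≤ α < 1`), THEOREMS ONLY:
* §1 `𝔞 := Subalgebra.centralizer K {γ}`: **`chart_mem_iff_mem_centralizer`** (`c X ∈ T ↔ X ∈ 𝔞` on the ball: ★ `cayley_comm_of_comm` ∕ ★ C8b-frame `comm_of_cayley_comm`),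
  **`centralizer_comm_of_charpoly_separable`** (`𝔞` is commutative for `γ` regular semisimple: ★ `commute_of_commute_of_charpoly_separable`),
  **`inv_mem_centralizer_of_isUnit`** (★ `nonsing_inv_comm_of_comm`), **`isClosed_centralizer_matrix`** (Mathlib `Set.isClosed_centralizer`); plus the adapter
  **`forall_valBound_of_forall_mem_level_zero`** from ★ (M-3b)'s `∀ X ∈ Λ 0` spelling of `hc` to FILE 3a's `∀ X, ValBound α X →` spelling.
* §2 **`exists_antiFixed_scalar`**: at a place where `σ ≠ id` there is `θ ≠ 0`, `|θ| ≤ 1`, `σ θ = −θ` (`θ = qᵃ·(u − σ u)`, `q` the residue characteristic, ★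
  `exists_natCast_valuation_lt_one` + ★ DATUM `exists_mul_pow_le_one_of_lt_one`); **`tau_smul_of_antiFixed`**: `τ(θ • X) = −θ • τ X` (★ `tau_smul`) — FILE 3a's `hEθ` at `E := τ`.
* §3 **`eps_eps_of_rho`**: `ε (ε g) = g` (★ (TJ1) `tau_inv` + ★ `tau_tau`, `ρ` injective) — FILE 3a's `hεε` on any `A ≤ G`; **`forall_mem_epsCentralizer_iff_of_comm`**: on an
  abelian `A ∋ δ₀`, `a ∈ G̃_{δ₀ε} ↔ ε a = a` (★ `mem_epsCentralizer_iff_map_eq_of_commute`) — FILE 3a's `hP'ε` at `P′ := epsCentralizer ε δ₀`.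

HONEST LABEL: HC_CM is proved only modulo the 7 printed citations (2 remaining named inputs: hLiu418 = `stmt-HodgeConjecture-24832`, h413 = `stmt-HodgeConjecture-24833`)
until rung 0 closes; these letters are [H-♮] plumbing of the (J̃♭) row behind the OPEN (W-NP) socket and close nothing by themselves (REL ≠ ★ ≠ BUILT; count-neutral).

## References
* [Rogawski1990] J. D. Rogawski, *Automorphic Representations of Unitary Groups in Three Variables*, Ann. of Math. Stud. 123 (1990), §3.10 p. 33 (the twist `ε`), §3.11
  Prop. 3.11.2 p. 35 (`G̃_{δε}`), §12.5 p. 186. Context locator.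
* [Serre1979] J.-P. Serre, *Local Fields*, GTM 67 (1979), VIII §4 (Herbrand quotient). Context locator.
* [PlatonovRapinchuk1994] V. Platonov, A. Rapinchuk, *Algebraic Groups and Number Theory* (1994), §3.3 (Cayley chart). Context locator.
-/

set_option autoImplicit false
-- the mandated namespace repeats the single-problem summit's segment (`HodgeConjecture.HodgeConjecture`)
set_option linter.dupNamespace false

open Set Matrix ValuativeRel
open Literature.NumberTheory.Automorphic Literature.NumberTheory.Weil1982.UnitaryFinTopForm
open Literature.NumberTheory.Rogawski1990.Ch4Sec10 (epsCentralizer)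
open Summit.HodgeConjecture.HodgeConjecture.Cruxes.H413.F0P3cStCharTSJacCartanModelFrame (comm_of_cayley_comm exists_natCast_valuation_lt_one)
open Summit.HodgeConjecture.HodgeConjecture.Cruxes.H413.F0P3cStCharTSJacCartanWeight (tau_smul tau_tau)
open scoped MatrixGroups

namespace Summit.HodgeConjecture.HodgeConjecture.R90.S4

/-! ## §1 The commutant algebra `𝔞 = Subalgebra.centralizer K {γ}` and the chart -/

section Centralizer

variable {K : Type*} [Field K] [ValuativeRel K] {m : ℕ} {G : Type*} [Group G] (ρ : G →* GL (Fin m) K)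

/-- **ADAPTER** from ★ (M-3b)'s `∀ X ∈ Λ 0` spelling of the chart letter to FILE 3a's `∀ X, ValBound α X →` spelling (`Λ 0 = {X ≤ α}`). [cite: PlatonovRapinchuk1994, §3.3] -/
theorem forall_valBound_of_forall_mem_level_zero {Λ : ℕ → AddSubgroup (Matrix (Fin m) (Fin m) K)} {α : ValueGroupWithZero K}
    (hΛ : ∀ j X, X ∈ Λ j ↔ ValBound (α ^ (j + 1)) X) {P : Matrix (Fin m) (Fin m) K → Prop} (h : ∀ X ∈ Λ 0, P X) :
    ∀ X, ValBound α X → P X := fun X hX =>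
  h X ((hΛ 0 X).2 (by rwa [zero_add, pow_one]))

/-- **THE CHART LANDS IN `T = ρ⁻¹ Cent(γ)` EXACTLY OVER THE COMMUTANT ALGEBRA**: for `X` in the ball (`X ≤ α < 1`, `2 ≠ 0`) and a chart with `ρ(c X) = cayley X`,
`c X ∈ T ↔ X ∈ Subalgebra.centralizer K {γ}` — `cayley X` commutes with `γ` iff `X` does (★ `cayley_comm_of_comm`; ★ C8b-frame `comm_of_cayley_comm` at the trivial form).
FILE 3a's `h𝔞` at `𝔞 := Subalgebra.centralizer K {γ}`. [cite: PlatonovRapinchuk1994, §3.3] [cite: Rogawski1990, §12.5 p. 186] -/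
theorem chart_mem_iff_mem_centralizer {γ : GL (Fin m) K} {T : Subgroup G} (hT : ∀ g, g ∈ T ↔ ρ g * γ = γ * ρ g)
    (c : Matrix (Fin m) (Fin m) K → G) {α : ValueGroupWithZero K} (hα1 : α < 1) (h2 : (2 : K) ≠ 0)
    (hc : ∀ X, ValBound α X → ((ρ (c X) : GL (Fin m) K) : Matrix (Fin m) (Fin m) K) = cayley X) :
    ∀ X, ValBound α X → (c X ∈ T ↔ X ∈ Subalgebra.centralizer K ({((γ : GL (Fin m) K) : Matrix (Fin m) (Fin m) K)} : Set (Matrix (Fin m) (Fin m) K))) := by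
  intro X hX
  rw [hT, Units.ext_iff, Units.val_mul, Units.val_mul, hc X hX, Subalgebra.mem_centralizer_iff]
  simp only [Set.mem_singleton_iff, forall_eq]
  constructor
  · intro h
    have hU' : ((cayley X).map (RingHom.id K))ᵀ * (0 : Matrix (Fin m) (Fin m) K) * cayley X = 0 := by rw [Matrix.mul_zero, Matrix.zero_mul]
    exact (comm_of_cayley_comm (RingHom.id K) h2 hX hα1 hU' h).symm
  · intro h
    exact cayley_comm_of_comm (isUnit_det_one_sub_of_valBound hX hα1).1 h.symm

omit [ValuativeRel K] in
/-- **THE COMMUTANT OF A REGULAR SEMISIMPLE `γ` IS COMMUTATIVE** (`χ_γ` separable ⇒ `Z(γ) = K[γ]`, ★ `commute_of_commute_of_charpoly_separable`) — FILE 3a's `h𝔞c`.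
[cite: Rogawski1990, §3.1 p. 19] -/
theorem centralizer_comm_of_charpoly_separable {γ : Matrix (Fin m) (Fin m) K} (hγsep : γ.charpoly.Separable) :
    ∀ X ∈ Subalgebra.centralizer K ({γ} : Set (Matrix (Fin m) (Fin m) K)), ∀ Y ∈ Subalgebra.centralizer K ({γ} : Set (Matrix (Fin m) (Fin m) K)), X * Y = Y * X := by
  intro X hX Y hY
  rw [Subalgebra.mem_centralizer_iff] at hX hY
  have hX' : Commute X γ := (hX γ (Set.mem_singleton γ)).symm
  have hY' : Commute Y γ := (hY γ (Set.mem_singleton γ)).symm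
  exact (Literature.LinearAlgebra.Matrix.commute_of_commute_of_charpoly_separable hγsep hX' hY').eq

omit [ValuativeRel K] in
/-- **The commutant is closed under inverses**: `X ∈ Z(γ)`, `X` invertible ⇒ `X⁻¹ ∈ Z(γ)` (★ `nonsing_inv_comm_of_comm`) — FILE 3a's `h𝔞i`. [cite: PlatonovRapinchuk1994, §3.3] -/
theorem inv_mem_centralizer_of_isUnit {γ : Matrix (Fin m) (Fin m) K} :
    ∀ X ∈ Subalgebra.centralizer K ({γ} : Set (Matrix (Fin m) (Fin m) K)), IsUnit X.det → X⁻¹ ∈ Subalgebra.centralizer K ({γ} : Set (Matrix (Fin m) (Fin m) K)) := by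
  intro X hX hXu
  rw [Subalgebra.mem_centralizer_iff] at hX ⊢
  simp only [Set.mem_singleton_iff, forall_eq] at hX ⊢
  exact (nonsing_inv_comm_of_comm hXu hX.symm).symm

omit [ValuativeRel K] in
/-- **The commutant is closed** in `M_m(K)` (`K` a Hausdorff topological field): Mathlib `Set.isClosed_centralizer` — FILE 3a's `h𝔞cl`. [cite: Serre1979, VIII §4] -/
theorem isClosed_centralizer_matrix [TopologicalSpace K] [IsTopologicalRing K] [T2Space K] {γ : Matrix (Fin m) (Fin m) K} :
    IsClosed ((Subalgebra.centralizer K ({γ} : Set (Matrix (Fin m) (Fin m) K)) : Subalgebra K (Matrix (Fin m) (Fin m) K)) : Set (Matrix (Fin m) (Fin m) K)) := by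
  haveI : T2Space (Matrix (Fin m) (Fin m) K) := inferInstanceAs (T2Space (Fin m → Fin m → K))
  rw [Subalgebra.coe_centralizer]
  exact Set.isClosed_centralizer _

end Centralizer

/-! ## §2 An anti-fixed scalar `θ` and the slot `τ` -/

section AntiFixed

variable {K : Type*} [Field K] [ValuativeRel K] [TopologicalSpace K] [IsNonarchimedeanLocalField K] [CharZero K]

/-- **AN ANTI-FIXED SCALAR EXISTS WHERE `σ ≠ id`**: for an involution `σ` of a non-archimedean local field with `σ u ≠ u` for some `u`, there is `θ ≠ 0` with `|θ| ≤ 1` and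
`σ θ = −θ` — `θ := qᵃ · (u − σ u)` with `q` the residue characteristic (`σ q = q`, `|q| < 1`, ★ `exists_natCast_valuation_lt_one`) and `a` large (★ DATUM
`exists_mul_pow_le_one_of_lt_one`).  (At a non-split place `σ_w ≠ id`.)  FILE 3a's `(θ, hθ0, hθ1)`. [cite: Rogawski1990, §1.9 p. 8; §3.10 p. 33] -/
theorem exists_antiFixed_scalar (σ : K →+* K) (hσ2 : ∀ a, σ (σ a) = a) (hσne : ∃ u : K, σ u ≠ u) :
    ∃ θ : K, θ ≠ 0 ∧ valuation K θ ≤ 1 ∧ σ θ = -θ := by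
  obtain ⟨u, hu⟩ := hσne
  obtain ⟨q, hq0, hq1⟩ := exists_natCast_valuation_lt_one K
  obtain ⟨a, ha⟩ := exists_mul_pow_le_one_of_lt_one hq1 (valuation K (u - σ u))
  refine ⟨(q : K) ^ a * (u - σ u), mul_ne_zero (pow_ne_zero _ hq0) (sub_ne_zero.2 (Ne.symm hu)), ?_, ?_⟩
  · rw [map_mul, map_pow, mul_comm]
    exact ha
  · rw [map_mul, map_pow, map_natCast, map_sub, hσ2]
    ring

omit [ValuativeRel K] [TopologicalSpace K] [IsNonarchimedeanLocalField K] [CharZero K] in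
/-- **`τ(θ • X) = −θ • τ X` for an anti-fixed `θ`** (`τ X = J⁻¹ (X.map σ)ᵀ J` is `σ`-semilinear, ★ `tau_smul`) — FILE 3a's `hEθ` at `E := τ`. [cite: Rogawski1990, §3.10 p. 33] -/
theorem tau_smul_of_antiFixed {m : Type*} [Fintype m] [DecidableEq m] (σ : K →+* K) (J : Matrix m m K) {θ : K} (hθ : σ θ = -θ) :
    ∀ X : Matrix m m K, J⁻¹ * ((θ • X).map σ)ᵀ * J = -(θ • (J⁻¹ * (X.map σ)ᵀ * J)) := fun X => by
  rw [tau_smul, hθ, neg_smul]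

end AntiFixed

/-! ## §3 `ε ∘ ε = id` in the model frame, and `T′ = A^ε` on an abelian `A` -/

section Eps

variable {K : Type*} [Field K] {m : ℕ} {G : Type*} [Group G]

/-- **`ε (ε g) = g`** for the twist read by `ρ(ε g) = J⁻¹ ((ρ g)⁻¹.map σ)ᵀ J = τ((ρ g)⁻¹)` (`ρ` injective, `σ` an involution, `J` hermitian invertible):
`ρ(ε(ε g)) = τ((τ((ρ g)⁻¹))⁻¹) = τ(τ(ρ g)) = ρ g` (★ (TJ1) `tau_inv`, ★ `tau_tau`) — FILE 3a's `hεε` on any `A ≤ G`. [cite: Rogawski1990, §3.10 p. 33] [cite: PlatonovRapinchuk1994, §3.3] -/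
theorem eps_eps_of_rho (ρ : G →* GL (Fin m) K) (hρinj : Function.Injective ρ) (σ : K →+* K) (hσ2 : ∀ a, σ (σ a) = a)
    (J : Matrix (Fin m) (Fin m) K) (hJ : IsUnit J.det) (hJh : (J.map σ)ᵀ = J) (ε : G → G)
    (hερ : ∀ g : G, ((ρ (ε g) : GL (Fin m) K) : Matrix (Fin m) (Fin m) K) = J⁻¹ * ((((ρ g)⁻¹ : GL (Fin m) K) : Matrix (Fin m) (Fin m) K).map σ)ᵀ * J) :
    ∀ g, ε (ε g) = g := by
  intro g
  have hgu : IsUnit ((ρ g : GL (Fin m) K) : Matrix (Fin m) (Fin m) K).det := (Matrix.isUnit_iff_isUnit_det _).1 (Units.isUnit _)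
  have hgiu : IsUnit (((ρ g)⁻¹ : GL (Fin m) K) : Matrix (Fin m) (Fin m) K).det := (Matrix.isUnit_iff_isUnit_det _).1 (Units.isUnit _)
  -- `(ρ (ε g))⁻¹ = τ(ρ g)`
  have h1 : (((ρ (ε g))⁻¹ : GL (Fin m) K) : Matrix (Fin m) (Fin m) K) = J⁻¹ * (((ρ g : GL (Fin m) K) : Matrix (Fin m) (Fin m) K).map σ)ᵀ * J := by
    rw [Matrix.coe_units_inv, hερ g, ← tau_inv σ J hJ hgiu, Matrix.coe_units_inv, Matrix.nonsing_inv_nonsing_inv _ hgu]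
  apply hρinj
  apply Units.ext
  rw [hερ (ε g), h1, tau_tau σ J hJ hJh hσ2]

/-- **`T′ = A^ε` on an abelian `A ∋ δ₀`**: for `a ∈ A`, `a ∈ G̃_{δ₀ε} ↔ ε a = a` (★ `mem_epsCentralizer_iff_map_eq_of_commute`: `a` commutes with `δ₀`) — FILE 3a's `hP'ε` at
`P′ := epsCentralizer ε δ₀`. [cite: Rogawski1990, §3.11 Prop. 3.11.2 p. 35] -/
theorem forall_mem_epsCentralizer_iff_of_comm (ε : G →* G) {A : Subgroup G} (hAc : ∀ x ∈ A, ∀ y ∈ A, x * y = y * x) {δ₀ : G} (hδ₀ : δ₀ ∈ A) :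
    ∀ a ∈ A, a ∈ epsCentralizer ε δ₀ ↔ ε a = a := fun a ha =>
  mem_epsCentralizer_iff_map_eq_of_commute ε (hAc a ha δ₀ hδ₀)

end Eps

end Summit.HodgeConjecture.HodgeConjecture.R90.S4
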